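import Summits.Ventures.HodgeRepro2.T5GelfandUnimodular
import Summits.Ventures.HodgeRepro2.T5DvrFiniteQuotients
import Summits.Ventures.HodgeRepro2.T5HeckeAdjointHermitian

/-!
# `π(f)^* = π(f^*)` for `GL_n` over a local field, unconditionally

Tier-5 kernel support (blind cell pub-hodge-repro2, seat p8, gen 11). T5-77
(`T5HeckeAdjointHermitian`) proves, for a `G`-invariant hermitian form `B` on a representation
`ρ`, the adjointness `B(T v, w) = B(v, T^* w)` of the Hecke action on `ρ^K` (`T^*` the
∗-involution of T5-76, `T_g^* = T_{g⁻¹}`), under the two hypotheses «every `KgK/K` is finite»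
(`hK`) and «`#(Kg⁻¹K/K) = #(KgK/K)`» (`hU`, the counting form of unimodularity). For
`G = GL_n(F)`, `K = GL_n(R)`, `R` a discrete valuation ring with finite residue field, both are
now theorems (T5-104 + T5-105; T5-112), so the adjointness holds with no remaining hypothesis —
the sentence «the Hecke operators are adjoint for the Petersson product, `T_g^* = T_{g⁻¹}`» of
the record at the split places.

* `finite_orbit` / `instFiniteOrbit` — every `KgK/K` is finite (T5-104 + T5-105 for this `R`);
* `apply_heckeSMul_doubleCosetOp_eq_inv` — **`B(T_g v, w) = B(v, T_{g⁻¹} w)`**;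
* `apply_heckeSMul_eq_starOp` — **`B(T v, w) = B(v, T^* w)`** for every `T ∈ H(G, K)`.

Hypotheses as stated in the kernel: `R`, `F`, `ι` as in T5-105; `k` a field with a `StarRing`
structure (e.g. `ℂ`); `ρ` a representation of `GL ι F` on `V`; `B : V →ₗ⋆[k] V →ₗ[k] k`
`G`-invariant (`IsInvariantSesq ρ B`) and hermitian (`IsHermitian B`).
-/

namespace Summit.Ventures.HodgeRepro2.T5HeckeAdjointGLn

variable {R : Type*} [CommRing R] [IsDomain R] [IsDiscreteValuationRing R]
  [Finite (IsLocalRing.ResidueField R)]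
variable {F : Type*} [Field F] [Algebra R F] [IsFractionRing R F]
variable {ι : Type*} [Fintype ι] [DecidableEq ι]

/-- Every double-coset space `KgK/K` of `GL ι F`, `K = GL_n(R)`, is finite (T5-104 + T5-105). -/
theorem finite_orbit (g : GL ι F) :
    Finite (MulAction.orbit (Matrix.GeneralLinearGroup.map (n := ι) (algebraMap R F)).range
      (↑g : GL ι F ⧸ (Matrix.GeneralLinearGroup.map (n := ι) (algebraMap R F)).range)) :=
  T5CongruenceOrbitFinite.finite_orbit_of_finite_quotients
    (fun c hc => T5DvrFiniteQuotients.finite_quotient_span_singleton c hc) g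

/-- The finiteness of `KgK/K` as an instance (needed to form the double-coset operators `T_g`
of T5-53 in the statements below). -/
instance instFiniteOrbit (g : GL ι F) :
    Finite (MulAction.orbit (Matrix.GeneralLinearGroup.map (n := ι) (algebraMap R F)).range
      (↑g : GL ι F ⧸ (Matrix.GeneralLinearGroup.map (n := ι) (algebraMap R F)).range)) :=
  finite_orbit g

variable {k : Type*} [Field k] [StarRing k] {V : Type*} [AddCommGroup V] [Module k V]
  {ρ : Representation k (GL ι F) V} {B : V →ₗ⋆[k] V →ₗ[k] k}

/-- **`B(T_g v, w) = B(v, T_{g⁻¹} w)`** on `ρ^K` for a `G`-invariant hermitian form `B`,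
`G = GL ι F`, `K = GL_n(R)` — no remaining hypothesis. -/
theorem apply_heckeSMul_doubleCosetOp_eq_inv (hB : T5HeckeAdjointHermitian.IsInvariantSesq ρ B)
    (hH : T5HeckeAdjointHermitian.IsHermitian B) (g : GL ι F)
    (v w : LevelPositivity.invariants ρ
      (Matrix.GeneralLinearGroup.map (n := ι) (algebraMap R F)).range) :
    B (T5HeckePermutationModule.heckeSMul ρ
        (T5HeckeDoubleCoset.doubleCosetOp k
          (Matrix.GeneralLinearGroup.map (n := ι) (algebraMap R F)).range g) v) w =
      B v (T5HeckePermutationModule.heckeSMul ρ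
        (T5HeckeDoubleCoset.doubleCosetOp k
          (Matrix.GeneralLinearGroup.map (n := ι) (algebraMap R F)).range g⁻¹) w) :=
  T5HeckeAdjointHermitian.apply_heckeSMul_doubleCosetOp_eq_apply_heckeSMul_doubleCosetOp_inv
    (fun g => finite_orbit (R := R) g) hB hH g
    (T5GelfandUnimodular.ncard_orbit_inv_eq_GL (R := R) g) v w

/-- **`π(f)^* = π(f^*)`**: `B(T v, w) = B(v, T^* w)` for every `T ∈ H(GL ι F, GL_n(R))`, `T^*`
the ∗-involution of T5-76 — no remaining hypothesis. -/
theorem apply_heckeSMul_eq_starOp (hB : T5HeckeAdjointHermitian.IsInvariantSesq ρ B)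
    (hH : T5HeckeAdjointHermitian.IsHermitian B)
    (T : T5HeckePermutationModule.heckeAlgebra k
      (Matrix.GeneralLinearGroup.map (n := ι) (algebraMap R F)).range)
    (v w : LevelPositivity.invariants ρ
      (Matrix.GeneralLinearGroup.map (n := ι) (algebraMap R F)).range) :
    B (T5HeckePermutationModule.heckeSMul ρ T v) w =
      B v (T5HeckePermutationModule.heckeSMul ρ
        (T5HeckeStar.starOp (fun g => finite_orbit (R := R) g) T) w) :=
  T5HeckeAdjointHermitian.apply_heckeSMul_eq_apply_heckeSMul_starOp
    (fun g => finite_orbit (R := R) g)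
    (fun g => T5GelfandUnimodular.ncard_orbit_inv_eq_GL (R := R) g) hB hH T v w

end Summit.Ventures.HodgeRepro2.T5HeckeAdjointGLn
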